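import Summits.QuantumFields.YangMills.Theorems.LuscherReductionTwistedTraceScalingLatticeHS
import Summits.QuantumFields.YangMills.Theorems.LuscherReductionTwistedTraceScalingBaseOfCoarse
import HarnessLib

/-!
# COARSE-TAIL(L₁) REDUCED to COARSE-UPPER(L₁) + a fixed-lattice WINDOW FLOOR W(L₁) (the S2 statement), given the landed HS ratio (S1):
# the `L`-generic twin of the `OneSiteTail` glue (sub-stub C5b of the COARSE programme; route `LuscherReduction`, crux `TwistedTraceScaling`
# stmt-QuantumFields-20203, S-BASE `stub_fixedLatticeTraceLaw`; card `pub/ym-fleet/ym-luscher-20007-p1/Lines-base-coarse-cut.md`)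

The endorsed cut (owner T1, 2026-08-27) is S-BASE ⇐ COARSE-UPPER(L₁) ∧ COARSE-LOWER(L₁) ∧ COARSE-TAIL(L₁)
(`TwoLattice.Base.fixedLatticeTraceLaw_of_coarse`).  The closed child `OneSiteTail` (stmt-QuantumFields-20204) was S1 (HS ratio) + S2 (window
floor) + glue G1/G2 + ONE at one level.  This file ports G1/G2 to the torus `(ℤ/L₁)³` in the threshold currency `u(β) = Λ(β,L₁)/L₁` and
discharges S1 from the tree (`lat_hs_ratio`, p526680), so that

  ★ `coarseTail_of_upper_window (L₁) : COARSE-UPPER(L₁) → W(L₁) → COARSE-TAIL(L₁)`   (texts: hypotheses `hUp`/`hTail` of `…BaseOfCoarse`),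
  ★ `fixedLatticeTraceLaw_of_upper_lower_window (L₁) : COARSE-UPPER(L₁) → COARSE-LOWER(L₁) → W(L₁) → ⟨S-BASE at L₁⟩`,

where the fixed-lattice WINDOW FLOOR is
  `W(L₁) := ∀ c₁ > 0, ∃ g : ℕ → ℝ, g ≥ 0, (∀ t > 0, Summable (e^{−t·g k})), ∃ β₀, ∀ β ≥ β₀, ∀ k, λ_k ≤ exp(−u(β)·min(g k, c₁ log β))·λ₀`
(levels below femto energy `E·u` are counted, uniformly in `β`, by a Laplace-summable profile — on one site `g = (physLevel(k+1) − C₀)/32`,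
`OST.window_floor`).  So S-BASE = COARSE-UPPER + COARSE-LOWER + W: three outputs of ONE-style upper/lower lanes on `SU(2)^{3L₁³}`.
Steps: `traceBound_of_hs_of_windowFloor_lat` (G1: HS ∧ W ⇒ uniform bound `Σ_k x_k^T ≤ Z(s)` for `s ≤ 2Tu`), `coarseTail_of_traceBound_lat`
(G2: COARSE-UPPER at ONE level `K` with `Δ_K → ∞` splits `x_{k+K}^T ≤ x_K^{T₀} x_{k+K}^{T₁}`), window bookkeeping `window_of_eventually`.
HONEST FRAMING: glue only; W, COARSE-UPPER, COARSE-LOWER are OPEN fixed-lattice semiclassics; femto rung R2b1; not RG, not a gap, not Clay.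
-/

set_option autoImplicit false

noncomputable section

open MeasureTheory Filter Topology Real
open Literature.MathematicalPhysics.QuantumFieldTheory hiding SU2
open Literature.MathematicalPhysics.QuantumLattice
open Literature.Analysis.OperatorTheory.YMMatrixModel
open scoped BigOperators

namespace Summit.QuantumFields.YangMills.Theorems.FemtoTransferGap.TwoLattice

open Summit.QuantumFields.YangMills.Theorems.FemtoTransferGap
open Summit.QuantumFields.YangMills.Theorems.FemtoTransferGap.TraceDoor

namespace Base

variable (L1 : ℕ) [NeZero L1]

/-! ## §1 Bookkeeping -/

/-- From `β`-thresholds back to window statements at a fixed lattice size: if `P β` holds for all `β ≥ β₁`, it holds deep in the window at `L₁`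
(`InFemtoWindow lam β L₁` with `lam ≤ min 1 (1/(4 max β₁ 1))` forces `β ≥ 1/(4lam³) ≥ β₁`). [folklore] -/
theorem window_of_eventually {P : ℝ → Prop} {β1 : ℝ} (h : ∀ β : ℝ, β1 ≤ β → P β) :
    ∃ lam0 : ℝ, 0 < lam0 ∧ ∀ lam : ℝ, 0 < lam → lam ≤ lam0 → ∀ β : ℝ, InFemtoWindow lam β L1 → P β := by
  set M : ℝ := max β1 1 with hM
  have hM1 : 1 ≤ M := le_max_right _ _
  have hMpos : 0 < M := by linarith
  refine ⟨min 1 (1 / (4 * M)), lt_min one_pos (by positivity), fun lam hlam hle β hW => h β ?_⟩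
  have h1 : lam ≤ 1 := hle.trans (min_le_left _ _)
  have h2 : lam ≤ 1 / (4 * M) := hle.trans (min_le_right _ _)
  have h3 : M ≤ 1 / (4 * lam ^ 3) := BOHandover.le_of_small_lam hM1 hlam h1 h2
  exact ((le_max_left _ _).trans h3).trans (BOHandover.beta_ge_of_window hlam hW)

/-- `0 ≤ x_k ≤ 1` for the relative levels on any lattice (`β > 0`). [folklore] -/
theorem xval_mem {β : ℝ} (hβ : 0 < β) (k : ℕ) :
    0 ≤ levelValue su2Rep L1 β k / levelValue su2Rep L1 β 0 ∧ levelValue su2Rep L1 β k / levelValue su2Rep L1 β 0 ≤ 1 := by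
  have h0 : 0 < levelValue su2Rep L1 β 0 := levelValue_zero_su2Rep_pos L1 β
  refine ⟨div_nonneg (levelValue_su2Rep_nonneg L1 hβ.le k) h0.le, ?_⟩
  rw [div_le_one h0]
  exact levelValue_le_of_le (L := L1) hβ (Nat.zero_le k)

/-- `x_·` is antitone in the level on any lattice. [folklore] -/
theorem xval_anti {β : ℝ} (hβ : 0 < β) {j k : ℕ} (hjk : j ≤ k) :
    levelValue su2Rep L1 β k / levelValue su2Rep L1 β 0 ≤ levelValue su2Rep L1 β j / levelValue su2Rep L1 β 0 :=
  div_le_div_of_nonneg_right (levelValue_le_of_le (L := L1) hβ hjk) (levelValue_zero_su2Rep_pos L1 β).le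

/-! ## §2 G1: HS ratio ∧ window floor ⟹ uniform normalised-trace bound -/

/-- **G1 on the `L₁³` torus**: an HS ratio bound `Σ_{j≤n} x_j² ≤ Cβ^q` and a window floor `λ_k ≤ e^{−u·min(g_k, c₁ log β)}λ₀` with a
Laplace-summable profile `g` give, for every `s > 0`, a uniform bound `Σ_k x_k^T ≤ Z` for all large `β` and all `T` with `s ≤ 2T·u`. -/
theorem traceBound_of_hs_of_windowFloor_lat
    (hHS : ∃ C : ℝ, ∃ q : ℕ, ∃ β0 : ℝ, ∀ β : ℝ, β0 ≤ β → ∀ n : ℕ,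
      ∑ j : Fin (n + 1), (levelValue su2Rep L1 β j / levelValue su2Rep L1 β 0) ^ 2 ≤ C * β ^ q)
    (hW : ∀ c₁ : ℝ, 0 < c₁ → ∃ g : ℕ → ℝ, (∀ k, 0 ≤ g k) ∧
      (∀ t : ℝ, 0 < t → Summable fun k : ℕ => Real.exp (-t * g k)) ∧
      ∃ β0 : ℝ, ∀ β : ℝ, β0 ≤ β → ∀ k : ℕ,
        levelValue su2Rep L1 β k ≤
          Real.exp (-(luscherLambda β L1 / L1 * min (g k) (c₁ * Real.log β))) * levelValue su2Rep L1 β 0) :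
    ∀ s : ℝ, 0 < s → ∃ Z β1 : ℝ, ∀ β : ℝ, β1 ≤ β → ∀ T : ℕ,
      s ≤ 2 * ((T : ℝ) * (luscherLambda β L1 / L1)) →
        Summable (fun k : ℕ => (levelValue su2Rep L1 β k / levelValue su2Rep L1 β 0) ^ T) ∧
        ∑' k : ℕ, (levelValue su2Rep L1 β k / levelValue su2Rep L1 β 0) ^ T ≤ Z := by
  intro s hs
  obtain ⟨C, q, B1, hHS1⟩ := hHS
  have hc₁ : 0 < 4 * ((q : ℝ) + 1) / s := by positivity
  obtain ⟨g, hg0, hgsum, B2, hfloor⟩ := hW (4 * ((q : ℝ) + 1) / s) hc₁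
  have hs4 : 0 < s / 4 := by positivity
  have hG : Summable (fun k => Real.exp (-(s / 4) * g k)) := hgsum _ hs4
  have hs8 : 0 < s / 8 := by positivity
  obtain ⟨B3, hB3⟩ := eventually_unit_le L1 hs8
  refine ⟨(∑' k, Real.exp (-(s / 4) * g k)) + max C 0, max (max B1 B2) B3, fun β hB T hT => ?_⟩
  have hB1 : B1 ≤ β := le_trans ((le_max_left _ _).trans (le_max_left _ _)) hB
  have hB2 : B2 ≤ β := le_trans ((le_max_right _ _).trans (le_max_left _ _)) hB
  have hB3' : B3 ≤ β := le_trans (le_max_right _ _) hB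
  obtain ⟨hBone, hupos, hus⟩ := hB3 β hB3'
  have hBpos : 0 < β := by linarith
  set u : ℝ := luscherLambda β L1 / L1 with hu
  have hlogB : 0 ≤ Real.log β := Real.log_nonneg hBone
  -- T ≥ 4 ≥ 2
  have hT4 : (4 : ℝ) ≤ T := by
    by_contra h
    rw [not_le] at h
    have h1 : 2 * ((T : ℝ) * u) ≤ 2 * ((T : ℝ) * (s / 8)) :=
      mul_le_mul_of_nonneg_left (mul_le_mul_of_nonneg_left hus (Nat.cast_nonneg T)) (by norm_num)
    nlinarith
  have hT2 : 2 ≤ T := by exact_mod_cast (show (2 : ℝ) ≤ T by linarith)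
  have hTsub : (((T - 2 : ℕ) : ℝ)) = (T : ℝ) - 2 := by
    rw [Nat.cast_sub hT2]; norm_num
  have hTl : s / 4 ≤ ((T - 2 : ℕ) : ℝ) * u := by
    rw [hTsub]
    nlinarith
  -- the normalised values
  have h0pos : 0 < levelValue su2Rep L1 β 0 := levelValue_zero_su2Rep_pos L1 β
  have hx0 : ∀ k, 0 ≤ levelValue su2Rep L1 β k / levelValue su2Rep L1 β 0 := fun k => (xval_mem L1 hBpos k).1
  have hx1 : ∀ k, levelValue su2Rep L1 β k / levelValue su2Rep L1 β 0 ≤ 1 := fun k => (xval_mem L1 hBpos k).2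
  -- Hilbert–Schmidt: summability and sum of squares (range form)
  have hrange : ∀ n : ℕ, ∑ j ∈ Finset.range n, (levelValue su2Rep L1 β j / levelValue su2Rep L1 β 0) ^ 2 ≤ C * β ^ q := by
    intro n
    have h1 : ∑ j ∈ Finset.range n, (levelValue su2Rep L1 β j / levelValue su2Rep L1 β 0) ^ 2 ≤
        ∑ j ∈ Finset.range (n + 1), (levelValue su2Rep L1 β j / levelValue su2Rep L1 β 0) ^ 2 :=
      Finset.sum_le_sum_of_subset_of_nonneg (Finset.range_subset_range.2 (Nat.le_succ n)) fun j _ _ => pow_nonneg (hx0 j) 2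
    have h2 : ∑ j ∈ Finset.range (n + 1), (levelValue su2Rep L1 β j / levelValue su2Rep L1 β 0) ^ 2 =
        ∑ j : Fin (n + 1), (levelValue su2Rep L1 β j / levelValue su2Rep L1 β 0) ^ 2 :=
      (Finset.sum_range fun j => (levelValue su2Rep L1 β j / levelValue su2Rep L1 β 0) ^ 2)
    rw [h2] at h1
    exact h1.trans (hHS1 β hB1 n)
  have hsum2 : Summable (fun k : ℕ => (levelValue su2Rep L1 β k / levelValue su2Rep L1 β 0) ^ 2) :=
    summable_of_sum_range_le (fun k => pow_nonneg (hx0 k) 2) hrange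
  have htsum2 : ∑' k, (levelValue su2Rep L1 β k / levelValue su2Rep L1 β 0) ^ 2 ≤ C * β ^ q :=
    Real.tsum_le_of_sum_range_le (fun k => pow_nonneg (hx0 k) 2) hrange
  -- summability of the T-th powers
  have hxT2 : ∀ k, (levelValue su2Rep L1 β k / levelValue su2Rep L1 β 0) ^ T ≤
      (levelValue su2Rep L1 β k / levelValue su2Rep L1 β 0) ^ 2 := fun k => pow_le_pow_of_le_one (hx0 k) (hx1 k) hT2
  have hsumT : Summable (fun k : ℕ => (levelValue su2Rep L1 β k / levelValue su2Rep L1 β 0) ^ T) :=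
    Summable.of_nonneg_of_le (fun k => pow_nonneg (hx0 k) T) hxT2 hsum2
  refine ⟨hsumT, ?_⟩
  -- the window constant: exp(-(s/4)·(c₁ log β)) = (β^(q+1))⁻¹
  have hwin : Real.exp (-(s / 4 * (4 * ((q : ℝ) + 1) / s * Real.log β))) = (β ^ (q + 1))⁻¹ := by
    have h1 : s / 4 * (4 * ((q : ℝ) + 1) / s * Real.log β) = ((q + 1 : ℕ) : ℝ) * Real.log β := by
      push_cast; field_simp
    rw [h1, Real.exp_neg, Real.exp_nat_mul, Real.exp_log hBpos]
  -- termwise bound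
  have hterm : ∀ k, (levelValue su2Rep L1 β k / levelValue su2Rep L1 β 0) ^ T ≤
      Real.exp (-(s / 4) * g k) + (β ^ (q + 1))⁻¹ * (levelValue su2Rep L1 β k / levelValue su2Rep L1 β 0) ^ 2 := by
    intro k
    set x : ℝ := levelValue su2Rep L1 β k / levelValue su2Rep L1 β 0 with hxdef
    set m : ℝ := min (g k) (4 * ((q : ℝ) + 1) / s * Real.log β) with hmdef
    have hm0 : 0 ≤ m := le_min (hg0 k) (by positivity)
    have hxle : x ≤ Real.exp (-(u * m)) := by
      rw [hxdef, div_le_iff₀ h0pos]; exact hfloor β hB2 k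
    have hsplit : x ^ T = x ^ (T - 2) * x ^ 2 := by
      rw [← pow_add, Nat.sub_add_cancel hT2]
    have hpow : x ^ (T - 2) ≤ Real.exp (-(s / 4 * m)) := by
      calc x ^ (T - 2) ≤ Real.exp (-(u * m)) ^ (T - 2) := pow_le_pow_left₀ (hx0 k) hxle _
        _ = Real.exp (-(((T - 2 : ℕ) : ℝ) * u * m)) := by
            rw [← Real.exp_nat_mul]; congr 1; ring
        _ ≤ Real.exp (-(s / 4 * m)) := by
            refine Real.exp_le_exp.2 ?_
            have := mul_le_mul_of_nonneg_right hTl hm0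
            linarith
    have hmin : Real.exp (-(s / 4 * m)) ≤ Real.exp (-(s / 4 * g k)) + (β ^ (q + 1))⁻¹ := by
      rw [← hwin, hmdef]
      rcases min_choice (g k) (4 * ((q : ℝ) + 1) / s * Real.log β) with h | h <;> rw [h]
      · linarith [Real.exp_pos (-(s / 4 * (4 * ((q : ℝ) + 1) / s * Real.log β)))]
      · linarith [Real.exp_pos (-(s / 4 * g k))]
    have hx2le : x ^ 2 ≤ 1 := pow_le_one₀ (hx0 k) (hx1 k)
    have hx2nn : 0 ≤ x ^ 2 := pow_nonneg (hx0 k) 2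
    have hE0 : 0 ≤ Real.exp (-(s / 4 * g k)) := (Real.exp_pos _).le
    calc x ^ T = x ^ (T - 2) * x ^ 2 := hsplit
      _ ≤ (Real.exp (-(s / 4 * g k)) + (β ^ (q + 1))⁻¹) * x ^ 2 :=
          mul_le_mul_of_nonneg_right (hpow.trans hmin) hx2nn
      _ = Real.exp (-(s / 4 * g k)) * x ^ 2 + (β ^ (q + 1))⁻¹ * x ^ 2 := by ring
      _ ≤ Real.exp (-(s / 4 * g k)) * 1 + (β ^ (q + 1))⁻¹ * x ^ 2 := by
          have := mul_le_mul_of_nonneg_left hx2le hE0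
          linarith
      _ = Real.exp (-(s / 4) * g k) + (β ^ (q + 1))⁻¹ * x ^ 2 := by ring_nf
  -- sum up
  have hsumR : Summable (fun k : ℕ => Real.exp (-(s / 4) * g k) +
      (β ^ (q + 1))⁻¹ * (levelValue su2Rep L1 β k / levelValue su2Rep L1 β 0) ^ 2) :=
    hG.add (hsum2.mul_left _)
  have hCB : (β ^ (q + 1))⁻¹ * (C * β ^ q) ≤ max C 0 := by
    have hBq : 0 < β ^ q := pow_pos hBpos q
    have h1 : (β ^ (q + 1))⁻¹ * (C * β ^ q) = C / β := by
      rw [pow_succ]; field_simp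
    rw [h1]
    by_cases hC : 0 ≤ C
    · calc C / β ≤ C := div_le_self hC hBone
        _ ≤ max C 0 := le_max_left _ _
    · exact le_trans (div_nonpos_of_nonpos_of_nonneg (le_of_lt (lt_of_not_ge hC)) hBpos.le) (le_max_right _ _)
  calc ∑' k, (levelValue su2Rep L1 β k / levelValue su2Rep L1 β 0) ^ T
      ≤ ∑' k, (Real.exp (-(s / 4) * g k) + (β ^ (q + 1))⁻¹ * (levelValue su2Rep L1 β k / levelValue su2Rep L1 β 0) ^ 2) :=
        Summable.tsum_le_tsum hterm hsumT hsumR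
    _ = (∑' k, Real.exp (-(s / 4) * g k)) + (β ^ (q + 1))⁻¹ * ∑' k, (levelValue su2Rep L1 β k / levelValue su2Rep L1 β 0) ^ 2 := by
        rw [hG.tsum_add (hsum2.mul_left _), tsum_mul_left]
    _ ≤ (∑' k, Real.exp (-(s / 4) * g k)) + (β ^ (q + 1))⁻¹ * (C * β ^ q) := by
        have := mul_le_mul_of_nonneg_left htsum2 (inv_nonneg.2 (pow_nonneg hBpos.le (q + 1)))
        linarith
    _ ≤ (∑' k, Real.exp (-(s / 4) * g k)) + max C 0 := by linarith

/-! ## §3 G2: uniform trace bound ∧ COARSE-UPPER at one level ⟹ COARSE-TAIL (threshold currency) -/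

/-- **G2 on the `L₁³` torus**: a uniform normalised-trace bound and COARSE-UPPER (used at a single level `K` with `Δ_K → ∞`, threshold currency)
give the tail bound `Σ_k x_{k+K}^T ≤ ε` for all large `β` and all `T` with `s ≤ 2T·u`. -/
theorem coarseTail_of_traceBound_lat
    (hUpβ : ∀ k : ℕ, ∀ d : ℝ, d < levelGap k → ∃ β1 : ℝ, ∀ β : ℝ, β1 ≤ β →
      levelValue su2Rep L1 β k ≤ Real.exp (-(d * luscherLambda β L1) / L1) * levelValue su2Rep L1 β 0)
    (hZ : ∀ s : ℝ, 0 < s → ∃ Z β1 : ℝ, ∀ β : ℝ, β1 ≤ β → ∀ T : ℕ,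
      s ≤ 2 * ((T : ℝ) * (luscherLambda β L1 / L1)) →
        Summable (fun k : ℕ => (levelValue su2Rep L1 β k / levelValue su2Rep L1 β 0) ^ T) ∧
        ∑' k : ℕ, (levelValue su2Rep L1 β k / levelValue su2Rep L1 β 0) ^ T ≤ Z) :
    ∀ s : ℝ, 0 < s → ∀ ε : ℝ, 0 < ε → ∃ K : ℕ, ∃ β1 : ℝ, ∀ β : ℝ, β1 ≤ β → ∀ T : ℕ,
      s ≤ 2 * ((T : ℝ) * (luscherLambda β L1 / L1)) →
        ∑' k : ℕ, (levelValue su2Rep L1 β (k + K) / levelValue su2Rep L1 β 0) ^ T ≤ ε := by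
  intro s hs ε hε
  obtain ⟨Z, B1, hZ1⟩ := hZ (s / 2) (by positivity)
  set M : ℝ := max Z 1 with hMdef
  have hM1 : 1 ≤ M := le_max_right _ _
  have hMpos : 0 < M := lt_of_lt_of_le one_pos hM1
  have hZM : Z ≤ M := le_max_left _ _
  -- choose the level K: Δ_K ≥ 1 and Δ_K ≥ (32/s)·log(M/ε)
  have htend : Tendsto (fun k : ℕ => levelGap k) atTop atTop := by
    have h1 : Tendsto (fun k : ℕ => physLevel (k + 1)) atTop atTop :=
      tendsto_physLevel_atTop.comp (tendsto_add_atTop_nat 1)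
    have h2 := tendsto_atTop_add_const_right atTop (-physLevel 1) h1
    refine h2.congr fun k => ?_
    unfold levelGap; ring
  obtain ⟨K, hK⟩ := (Filter.tendsto_atTop.1 htend (max 1 (32 / s * Real.log (M / ε)))).exists
  have hK1 : 1 ≤ levelGap K := le_trans (le_max_left _ _) hK
  have hKlog : 32 / s * Real.log (M / ε) ≤ levelGap K := le_trans (le_max_right _ _) hK
  have hΔpos : 0 < levelGap K := lt_of_lt_of_le one_pos hK1
  -- the key smallness: exp(-(s/32) Δ_K) ≤ ε / M
  have hsmall : Real.exp (-(s / 32 * levelGap K)) ≤ ε / M := by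
    have h1 : Real.log (M / ε) ≤ s / 32 * levelGap K := by
      have h2 : s / 32 * (32 / s * Real.log (M / ε)) ≤ s / 32 * levelGap K :=
        mul_le_mul_of_nonneg_left hKlog (by positivity)
      have h3 : s / 32 * (32 / s * Real.log (M / ε)) = Real.log (M / ε) := by
        field_simp
      linarith
    calc Real.exp (-(s / 32 * levelGap K)) ≤ Real.exp (-Real.log (M / ε)) :=
          Real.exp_le_exp.2 (by linarith)
      _ = ε / M := by rw [Real.exp_neg, Real.exp_log (by positivity)]; field_simp
  -- COARSE-UPPER at level K with d = Δ_K / 2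
  obtain ⟨B2, hUP⟩ := hUpβ K (levelGap K / 2) (by linarith)
  have hs4 : 0 < s / 4 := by positivity
  obtain ⟨B3, hB3⟩ := eventually_unit_le L1 hs4
  refine ⟨K, max (max B1 B2) B3, fun β hB T hT => ?_⟩
  have hB1 : B1 ≤ β := le_trans ((le_max_left _ _).trans (le_max_left _ _)) hB
  have hB2 : B2 ≤ β := le_trans ((le_max_right _ _).trans (le_max_left _ _)) hB
  have hB3' : B3 ≤ β := le_trans (le_max_right _ _) hB
  obtain ⟨hBone, hupos, hus⟩ := hB3 β hB3'
  have hBpos : 0 < β := by linarith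
  set l : ℝ := luscherLambda β L1 / L1 with hldef
  -- split T = T₀ + T₁ with T₀ = ⌊T/2⌋
  set T₀ : ℕ := T / 2 with hT₀def
  set T₁ : ℕ := T - T / 2 with hT₁def
  have hTsum : T₀ + T₁ = T := by omega
  have hT₁2 : T ≤ 2 * T₁ := by omega
  have hT₀2 : T ≤ 2 * T₀ + 1 := by omega
  have hT₁le : T₁ ≤ T := by omega
  have hT₁R : (T : ℝ) ≤ 2 * (T₁ : ℝ) := by exact_mod_cast hT₁2
  have hT₀R : (T : ℝ) ≤ 2 * (T₀ : ℝ) + 1 := by exact_mod_cast hT₀2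
  -- trace bound at s/2 with exponent T₁
  have hwin₁ : s / 2 ≤ 2 * ((T₁ : ℝ) * l) := by
    have h1 : (T : ℝ) * l ≤ 2 * ((T₁ : ℝ) * l) := by
      have := mul_le_mul_of_nonneg_right hT₁R hupos.le
      linarith
    linarith
  obtain ⟨hsum₁, hle₁⟩ := hZ1 β hB1 T₁ hwin₁
  -- pointwise facts about x_k
  set x : ℕ → ℝ := fun k => levelValue su2Rep L1 β k / levelValue su2Rep L1 β 0 with hxdef
  have hx0 : ∀ k, 0 ≤ x k := fun k => (xval_mem L1 hBpos k).1
  have hx1 : ∀ k, x k ≤ 1 := fun k => (xval_mem L1 hBpos k).2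
  have hxT_le : ∀ k, x k ^ T ≤ x k ^ T₁ := fun k => pow_le_pow_of_le_one (hx0 k) (hx1 k) hT₁le
  have hsumT : Summable (fun k : ℕ => x k ^ T) :=
    Summable.of_nonneg_of_le (fun k => pow_nonneg (hx0 k) T) hxT_le hsum₁
  -- COARSE-UPPER at level K: x_K ≤ exp(-(Δ_K/2) l)
  have h0pos : 0 < levelValue su2Rep L1 β 0 := levelValue_zero_su2Rep_pos L1 β
  have hxK : x K ≤ Real.exp (-(levelGap K / 2 * l)) := by
    show levelValue su2Rep L1 β K / levelValue su2Rep L1 β 0 ≤ _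
    rw [div_le_iff₀ h0pos]
    have h := hUP β hB2
    have e : -(levelGap K / 2 * luscherLambda β L1) / L1 = -(levelGap K / 2 * l) := by rw [hldef]; ring
    rwa [e] at h
  -- exponent bookkeeping: T₀ l ≥ s/8, so T₀ (Δ_K/2) l ≥ (s/16)(Δ_K/2)… we use (s/32)Δ_K
  have hT₀l : s / 8 ≤ (T₀ : ℝ) * l := by
    have h1 : (T : ℝ) * l ≤ 2 * ((T₀ : ℝ) * l) + l := by
      have := mul_le_mul_of_nonneg_right hT₀R hupos.le
      linarith
    linarith
  have hexpo : s / 32 * levelGap K ≤ (T₀ : ℝ) * (levelGap K / 2 * l) := by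
    have h2 : s / 8 * (levelGap K / 2) ≤ (T₀ : ℝ) * l * (levelGap K / 2) :=
      mul_le_mul_of_nonneg_right hT₀l (by positivity)
    have h3 : (T₀ : ℝ) * (levelGap K / 2 * l) = (T₀ : ℝ) * l * (levelGap K / 2) := by ring
    have h4 : s / 32 * levelGap K ≤ s / 8 * (levelGap K / 2) := by nlinarith
    linarith
  have hxKT : x K ^ T₀ ≤ ε / M := by
    calc x K ^ T₀ ≤ Real.exp (-(levelGap K / 2 * l)) ^ T₀ := pow_le_pow_left₀ (hx0 K) hxK T₀
      _ = Real.exp (-((T₀ : ℝ) * (levelGap K / 2 * l))) := by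
          rw [← Real.exp_nat_mul]; congr 1; ring
      _ ≤ Real.exp (-(s / 32 * levelGap K)) := Real.exp_le_exp.2 (by linarith)
      _ ≤ ε / M := hsmall
  -- termwise: x_{k+K}^T ≤ x_K^{T₀} · x_{k+K}^{T₁}
  have hterm : ∀ k, x (k + K) ^ T ≤ x K ^ T₀ * x (k + K) ^ T₁ := fun k => by
    rw [← hTsum, pow_add]
    refine mul_le_mul_of_nonneg_right ?_ (pow_nonneg (hx0 _) _)
    exact pow_le_pow_left₀ (hx0 _) (xval_anti L1 hBpos (Nat.le_add_left K k)) T₀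
  have hsum₁K : Summable (fun k : ℕ => x (k + K) ^ T₁) :=
    (summable_nat_add_iff (f := fun k : ℕ => x k ^ T₁) K).2 hsum₁
  have hsumTK : Summable (fun k : ℕ => x (k + K) ^ T) :=
    (summable_nat_add_iff (f := fun k : ℕ => x k ^ T) K).2 hsumT
  have htail₁ : ∑' k, x (k + K) ^ T₁ ≤ ∑' k, x k ^ T₁ := by
    have h := hsum₁.sum_add_tsum_nat_add K
    have h2 : 0 ≤ ∑ i ∈ Finset.range K, x i ^ T₁ := Finset.sum_nonneg fun i _ => pow_nonneg (hx0 i) _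
    linarith
  have htail₁0 : 0 ≤ ∑' k, x (k + K) ^ T₁ := tsum_nonneg fun k => pow_nonneg (hx0 _) _
  calc ∑' k, x (k + K) ^ T ≤ ∑' k, x K ^ T₀ * x (k + K) ^ T₁ :=
        Summable.tsum_le_tsum hterm hsumTK (hsum₁K.mul_left _)
    _ = x K ^ T₀ * ∑' k, x (k + K) ^ T₁ := tsum_mul_left
    _ ≤ ε / M * ∑' k, x k ^ T₁ :=
        mul_le_mul hxKT htail₁ htail₁0 (by positivity)
    _ ≤ ε / M * M := mul_le_mul_of_nonneg_left (hle₁.trans hZM) (by positivity)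
    _ = ε := div_mul_cancel₀ ε hMpos.ne'

/-! ## §4 The reductions in the texts of the cut -/

/-- ★ **COARSE-TAIL(L₁) from COARSE-UPPER(L₁) and the fixed-lattice window floor W(L₁)** (S1 = `lat_hs_ratio` from the tree; hypothesis and
conclusion texts = `hUp` / `hTail` of `Base.fixedLatticeTraceLaw_of_coarse`, verbatim). -/
theorem coarseTail_of_upper_window
    (hUp : ∀ k : ℕ, ∀ d : ℝ, d < levelGap k → ∃ lam0 : ℝ, 0 < lam0 ∧ ∀ lam : ℝ, 0 < lam → lam ≤ lam0 →
      ∀ β : ℝ, InFemtoWindow lam β L1 →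
        levelValue su2Rep L1 β k ≤ Real.exp (-(d * luscherLambda β L1) / L1) * levelValue su2Rep L1 β 0)
    (hW : ∀ c₁ : ℝ, 0 < c₁ → ∃ g : ℕ → ℝ, (∀ k, 0 ≤ g k) ∧
      (∀ t : ℝ, 0 < t → Summable fun k : ℕ => Real.exp (-t * g k)) ∧
      ∃ β0 : ℝ, ∀ β : ℝ, β0 ≤ β → ∀ k : ℕ,
        levelValue su2Rep L1 β k ≤
          Real.exp (-(luscherLambda β L1 / L1 * min (g k) (c₁ * Real.log β))) * levelValue su2Rep L1 β 0) :
    ∀ s : ℝ, 0 < s → ∀ ε : ℝ, 0 < ε → ∃ K : ℕ, ∃ lam0 : ℝ, 0 < lam0 ∧ ∀ lam : ℝ, 0 < lam → lam ≤ lam0 →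
      ∀ β : ℝ, InFemtoWindow lam β L1 → ∀ T : ℕ, s ≤ 2 * ((T : ℝ) * (luscherLambda β L1 / L1)) →
        ∑' k : ℕ, (levelValue su2Rep L1 β (k + K) / levelValue su2Rep L1 β 0) ^ T ≤ ε := by
  -- COARSE-UPPER in threshold currency
  have hUpβ : ∀ k : ℕ, ∀ d : ℝ, d < levelGap k → ∃ β1 : ℝ, ∀ β : ℝ, β1 ≤ β →
      levelValue su2Rep L1 β k ≤ Real.exp (-(d * luscherLambda β L1) / L1) * levelValue su2Rep L1 β 0 := by
    intro k d hd
    obtain ⟨lam0, hlam0, h⟩ := hUp k d hd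
    exact eventually_of_window L1 hlam0 h
  -- S1 from the tree
  have hHS : ∃ C : ℝ, ∃ q : ℕ, ∃ β0 : ℝ, ∀ β : ℝ, β0 ≤ β → ∀ n : ℕ,
      ∑ j : Fin (n + 1), (levelValue su2Rep L1 β j / levelValue su2Rep L1 β 0) ^ 2 ≤ C * β ^ q := lat_hs_ratio L1
  have hZ := traceBound_of_hs_of_windowFloor_lat L1 hHS hW
  intro s hs ε hε
  obtain ⟨K, β1, hK⟩ := coarseTail_of_traceBound_lat L1 hUpβ hZ s hs ε hε
  obtain ⟨lam0, hlam0, h⟩ := window_of_eventually L1 (P := fun β => ∀ T : ℕ,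
    s ≤ 2 * ((T : ℝ) * (luscherLambda β L1 / L1)) →
      ∑' k : ℕ, (levelValue su2Rep L1 β (k + K) / levelValue su2Rep L1 β 0) ^ T ≤ ε) hK
  exact ⟨K, lam0, hlam0, h⟩

/-- ★★ **S-BASE at `L₁` from COARSE-UPPER(L₁), COARSE-LOWER(L₁) and the window floor W(L₁)** — the endorsed cut with its tail piece traded for
the window floor (S1 discharged from the tree). [cite: Luscher1983, §3] [cite: MontvayMunster1994, (3.145)] -/
theorem fixedLatticeTraceLaw_of_upper_lower_window
    (hUp : ∀ k : ℕ, ∀ d : ℝ, d < levelGap k → ∃ lam0 : ℝ, 0 < lam0 ∧ ∀ lam : ℝ, 0 < lam → lam ≤ lam0 →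
      ∀ β : ℝ, InFemtoWindow lam β L1 →
        levelValue su2Rep L1 β k ≤ Real.exp (-(d * luscherLambda β L1) / L1) * levelValue su2Rep L1 β 0)
    (hLow : ∀ k : ℕ, ∀ ε : ℝ, 0 < ε → ∃ lam0 : ℝ, 0 < lam0 ∧ ∀ lam : ℝ, 0 < lam → lam ≤ lam0 →
      ∀ β : ℝ, InFemtoWindow lam β L1 →
        Real.exp (-((levelGap k + ε) * luscherLambda β L1) / L1) * levelValue su2Rep L1 β 0 ≤ levelValue su2Rep L1 β k)
    (hW : ∀ c₁ : ℝ, 0 < c₁ → ∃ g : ℕ → ℝ, (∀ k, 0 ≤ g k) ∧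
      (∀ t : ℝ, 0 < t → Summable fun k : ℕ => Real.exp (-t * g k)) ∧
      ∃ β0 : ℝ, ∀ β : ℝ, β0 ≤ β → ∀ k : ℕ,
        levelValue su2Rep L1 β k ≤
          Real.exp (-(luscherLambda β L1 / L1 * min (g k) (c₁ * Real.log β))) * levelValue su2Rep L1 β 0) :
    ∀ s : ℝ, 0 < s → ∀ ε : ℝ, 0 < ε → ∃ β1 : ℝ, ∀ β : ℝ, β1 ≤ β →
      |traceRatio L1 β (femtoSteps s β L1) - hTraceRatio s| ≤ ε :=
  fixedLatticeTraceLaw_of_coarse L1 hUp hLow (coarseTail_of_upper_window L1 hUp hW)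

end Base

end Summit.QuantumFields.YangMills.Theorems.FemtoTransferGap.TwoLattice

end
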